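import Summits.HodgeConjecture.HodgeConjecture.Theorems.LinearSystemTorelliMiddleDivisorSupportFourfoldStubFiniteMonodromyOfTypeStability
import Summits.HodgeConjecture.HodgeConjecture.Theorems.LinearSystemTorelliMiddleDivisorSupportFourfoldStubConnectedWeakDescentQbar
import Summits.HodgeConjecture.HodgeConjecture.Theorems.LinearSystemTorelliMiddleDivisorSupportFourfoldStubDominantEnvelope
import Summits.HodgeConjecture.HodgeConjecture.Theorems.LinearSystemTorelliMiddleDivisorSupportFourfoldOfLineResidue
import HarnessLib

/-!
# Route `LinearSystemTorelli` — crux `MiddleDivisorSupportFourfold` (stmt-HodgeConjecture-2409):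
# the residue of line `IdeatorFiveSketch` with TWO classical debts (lead c10)

Helper file for the crux item stmt-HodgeConjecture-2409 (`--supports`; it closes nothing), line
`IdeatorFiveSketch` (idea `weakly-nonfactor-descent`), lead c10.  Lead c9's kernel-checked residue
(`linearSystemTorelli_middleDivisorSupportFourfold_of_lineResidue_of_weakDescent`, p126502) read

  `ClassicalGeometricVHS → QbarGenericIsHodgeGeneric → HodgeConjectureQbar →
   bku_finite_monodromyOrbit_of_isHodgeGenericIn → riemannExistence_finiteCovering →
   LinearSystemTorelli.DeligneGlobalInvariantCycles → MiddleDivisorSupportFourfold`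

— three open route items and THREE classical named-fact debts.  The A-side of the line has since
become unconditional (`stub_finiteMonodromyAtGenericSpread_of_typeStabilityAtQbarGeneric`, file
`…StubFiniteMonodromyOfTypeStability`: the Hodge–Riemann input of the BKU fact is PROVED in the tree,
`hodgeRiemann_polarizationForm_qbarFamily`, and the lattice argument is assembled), so the residue is
now

  T → HodgeConjectureQbar → riemannExistence_finiteCovering →
  LinearSystemTorelli.DeligneGlobalInvariantCycles → MiddleDivisorSupportFourfold

(`linearSystemTorelli_middleDivisorSupportFourfold_of_lineResidue_of_typeStability`), where T is the
exact transcendence kernel "in a smooth projective `ℚ̄`-family of fourfolds, at a point over the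
generic point of the smooth irreducible base, every loop-continuation of a rational `(2,2)`-class is
of type `(2,2)`" (OPEN; implied by HC(4,2), and by stmt-11597 ∧ stmt-11595 ∧ Deligne–André type
stability, `linearSystemTorelli_typeStabilityAtQbarGeneric_of_qbarGenericIsHodgeGeneric_of_hType`):
TWO open inputs {T, HC/`ℚ̄` (stmt-11596; only its codimension-2 slice for one `σ` is consumed,
`…_of_typeStability_of_hcQbarCodimTwo`)} and TWO classical debts {Riemann's existence theorem over
`ℂ` in covering form (SGA1 XII 5.1, named fact `FundamentalGroup.riemannExistence_finiteCovering`),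
Deligne's théorème de la partie fixe (Hodge II 4.1.1) = route item stmt-16363}.  Everything else in
Voisin's `ℚ̄`-funnel for divisor support — spreading out, Hodge–Riemann and the lattice finiteness,
weak `ℚ̄`-descent of finite étale covers, Hironaka over `ℚ̄`, the dominance glue, the Charles–Schnell
`ℚ̄`-support fact — is PROVED in the tree.
-/

-- every declaration of this problem lives in `Summit.HodgeConjecture.HodgeConjecture.…`
set_option linter.dupNamespace false

noncomputable section

namespace Summit.HodgeConjecture.HodgeConjecture.Theorems

open CategoryTheory AlgebraicGeometry
open _root_.Topology
open Summit.HodgeConjecture.HodgeConjecture.Theses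
open Literature.AlgebraicGeometry Literature.AlgebraicGeometry.Motives
open Literature.AlgebraicGeometry.HodgeTheory
open Literature.AlgebraicTopology.SingularHomology

/-- **DominantQbarEnvelope(4,2) ⟸ T modulo Riemann existence with `ℚ̄`-descent (C) and Deligne's
partie fixe (D).** For a fixed `σ : ℚ̄ →+* ℂ`, every rational `(2,2)`-class `c` on a smooth projective
complex fourfold `X` is `ι^* c'` for a `ℂ`-morphism `ι : X ⟶ W₀ ⊗_σ ℂ`, DOMINANT onto the `ℚ̄`-scheme
`W₀` (smooth projective complexification), and a rational `(2,2)`-class `c'` upstairs: spread `X`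
and get finite monodromy from type stability
(`stub_finiteMonodromyAtGenericSpread_of_typeStabilityAtQbarGeneric`, unconditional), then take the
dominant envelope of the transported class (`stub_dominantEnvelopeOfFiniteMonodromy`, stub B, p119525)
and precompose with `e : X ≅ 𝒳_s`.
[cite: Voisin2007HodgeLoci, §3, proof of Prop. 0.7] [cite: CharlesSchnell2014Notes, Thm. 11.3.19] -/
theorem linearSystemTorelli_dominantQbarEnvelopeFourfoldCodimTwo_of_typeStability
    (hT : ∀ (σ : AlgebraicClosure ℚ →+* ℂ) ⦃𝒳₀ S₀ : SchemeOver (AlgebraicClosure ℚ)⦄ (f₀ : 𝒳₀ ⟶ S₀),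
      IsQuasiProjectiveOver 𝒳₀ → IsQuasiProjectiveOver S₀ → IrreducibleSpace S₀.left →
      AlgebraicGeometry.Smooth S₀.hom → IsSmoothProjectiveFamily ((baseChangeHom σ).map f₀) 4 →
      ∀ (s : ComplexPoints ((baseChangeHom σ).obj S₀)),
        closure {(baseChangeHomFst σ S₀).base s.pt} = (Set.univ : Set S₀.left) →
        ∀ (α : complexBetti (fiberOver ((baseChangeHom σ).map f₀) s) 4),
          IsRationalClass α → IsOfHodgeType 4 (fiberOver ((baseChangeHom σ).map f₀) s) 4 2 2 α →
          ∀ (γ : Path s s) (β : complexBetti (fiberOver ((baseChangeHom σ).map f₀) s) 4),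
            IsContinuationAlong γ α β →
              IsOfHodgeType 4 (fiberOver ((baseChangeHom σ).map f₀) s) 4 2 2 β)
    (hRE : Literature.AlgebraicGeometry.FundamentalGroup.riemannExistence_qbarDescent_of_finiteIndex)
    (hD : deligne_globalInvariantCycles) (σ : AlgebraicClosure ℚ →+* ℂ) :
    ∀ ⦃X : SchemeOver ℂ⦄, IsSmoothProjective 4 X → ∀ (c : complexBetti X 4), IsRationalClass c →
      IsOfHodgeType 4 X 4 2 2 c →
        ∃ (m : ℕ) (W₀ : SchemeOver (AlgebraicClosure ℚ)) (ι : X ⟶ (baseChangeHom σ).obj W₀)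
          (c' : complexBetti ((baseChangeHom σ).obj W₀) 4),
          IsSmoothProjective m ((baseChangeHom σ).obj W₀) ∧
          DenseRange (ι.left ≫ baseChangeHomFst σ W₀).base ∧
          IsRationalClass c' ∧ IsOfHodgeType m ((baseChangeHom σ).obj W₀) 4 2 2 c' ∧
          complexBetti.map ι 4 c' = c := by
  intro X hX c hc hh
  obtain ⟨𝒳₀, S₀, f₀, s, e, h𝒳₀, hS₀, hirr, hsm, hf, hgen, hfin⟩ :=
    stub_finiteMonodromyAtGenericSpread_of_typeStabilityAtQbarGeneric hT σ hX c hc hh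
  obtain ⟨m, W₀, ι, c', hW, hdom, hc', hh', hmap⟩ :=
    stub_dominantEnvelopeOfFiniteMonodromy hRE hD σ f₀ 4 2 h𝒳₀ hS₀ hirr hsm hf s hgen
      (complexBetti.map e.inv 4 c) (hc.map _) (hh.map_of_iso e.symm) hfin
  refine ⟨m, W₀, e.hom ≫ ι, c', hW, ?_, hc', hh', ?_⟩
  · have hsurj : Function.Surjective e.hom.left.base := e.hom.left.surjective
    have : ((e.hom ≫ ι).left ≫ baseChangeHomFst σ W₀).base =
        e.hom.left.base ≫ (ι.left ≫ baseChangeHomFst σ W₀).base := rfl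
    rw [this, TopCat.coe_comp]
    exact hdom.comp hsurj.denseRange (ι.left ≫ baseChangeHomFst σ W₀).base.hom.continuous
  · rw [complexBetti.map_comp, ModuleCat.comp_apply, hmap]
    exact e.complexBetti_map_hom_map_inv 4 c

/-- **stmt-2409 ⟸ T ∧ HC/`ℚ̄` modulo TWO classical debts** (registered sub-goal of the crux; the
kernel-checked residue of line `IdeatorFiveSketch` after lead c10; arrow form): the crux
`MiddleDivisorSupportFourfold` follows from type stability at `ℚ̄`-generic points (T) and
`PeriodDeficiency.HodgeConjectureQbar` (stmt-11596), modulo Riemann's existence theorem over `ℂ` in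
covering form (`FundamentalGroup.riemannExistence_finiteCovering`, SGA1 XII 5.1) and Deligne's
théorème de la partie fixe as the route item `LinearSystemTorelli.DeligneGlobalInvariantCycles`
(stmt-16363, Hodge II 4.1.1).  Compared with lead c9's residue
(`linearSystemTorelli_middleDivisorSupportFourfold_of_lineResidue_of_weakDescent`) the hypotheses
`ClassicalGeometricVHS`, `QbarGenericIsHodgeGeneric` and `bku_finite_monodromyOrbit_of_isHodgeGenericIn`
are replaced by T, which they imply
(`linearSystemTorelli_typeStabilityAtQbarGeneric_of_qbarGenericIsHodgeGeneric_of_hType` with the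
tree's `hodgeRiemann_polarizationForm_qbarFamily`).  Proof: fix `σ`; Riemann existence with
`ℚ̄`-descent from `hR` alone (weak descent PROVED, p126502/p126127); the dominant `ℚ̄`-envelope from
T (above); `ℚ̄`-rational divisor support upstairs from HC/`ℚ̄` with the discharged Charles–Schnell fact;
and the dominance glue `linearSystemTorelli_middleDivisorSupportFourfold_of_dominantQbarEnvelope`.
[cite: Voisin2007HodgeLoci, §3, proof of Prop. 0.7] [cite: CharlesSchnell2014Notes, Thm. 11.3.19]
[cite: SGA1, Exp. XII Thm. 5.1] [cite: DeligneHodgeII1971, Thm. 4.1.1] -/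
theorem linearSystemTorelli_middleDivisorSupportFourfold_of_lineResidue_of_typeStability :
    (∀ (σ : AlgebraicClosure ℚ →+* ℂ) ⦃𝒳₀ S₀ : SchemeOver (AlgebraicClosure ℚ)⦄ (f₀ : 𝒳₀ ⟶ S₀),
      IsQuasiProjectiveOver 𝒳₀ → IsQuasiProjectiveOver S₀ → IrreducibleSpace S₀.left →
      AlgebraicGeometry.Smooth S₀.hom → IsSmoothProjectiveFamily ((baseChangeHom σ).map f₀) 4 →
      ∀ (s : ComplexPoints ((baseChangeHom σ).obj S₀)),
        closure {(baseChangeHomFst σ S₀).base s.pt} = (Set.univ : Set S₀.left) →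
        ∀ (α : complexBetti (fiberOver ((baseChangeHom σ).map f₀) s) 4),
          IsRationalClass α → IsOfHodgeType 4 (fiberOver ((baseChangeHom σ).map f₀) s) 4 2 2 α →
          ∀ (γ : Path s s) (β : complexBetti (fiberOver ((baseChangeHom σ).map f₀) s) 4),
            IsContinuationAlong γ α β →
              IsOfHodgeType 4 (fiberOver ((baseChangeHom σ).map f₀) s) 4 2 2 β) →
    Summit.HodgeConjecture.HodgeConjecture.Theses.PeriodDeficiency.HodgeConjectureQbar →
    Literature.AlgebraicGeometry.FundamentalGroup.riemannExistence_finiteCovering →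
    Summit.HodgeConjecture.HodgeConjecture.Theses.LinearSystemTorelli.DeligneGlobalInvariantCycles →
    Summit.HodgeConjecture.HodgeConjecture.Theses.LinearSystemTorelli.MiddleDivisorSupportFourfold := by
  intro hT hQ hR hD
  obtain ⟨σ⟩ := exists_ringHom_algebraicClosure_rat_complex
  exact linearSystemTorelli_middleDivisorSupportFourfold_of_dominantQbarEnvelope σ
    (linearSystemTorelli_dominantQbarEnvelopeFourfoldCodimTwo_of_typeStability hT
      (linearSystemTorelli_riemannExistence_qbarDescent_of_finiteIndex_of_riemannExistence hR) hD σ)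
    (linearSystemTorelli_qbarDivisorSupportCodimTwo_of_hodgeConjectureQbar hQ σ)

/-- **The same with only the codimension-2 slice of the Hodge conjecture over `ℚ̄`** (for one fixed
`σ`: rational `(2,2)`-classes on every smooth projective `W₀ ⊗_σ ℂ` algebraic) — the exact pair of
open inputs {T, HC/`ℚ̄`(·,2)} of the line, modulo the same two classical debts.
[cite: Voisin2007HodgeLoci, §3, proof of Prop. 0.7] [cite: CharlesSchnell2014Notes, Thm. 11.3.19] -/
theorem linearSystemTorelli_middleDivisorSupportFourfold_of_typeStability_of_hcQbarCodimTwo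
    (hT : ∀ (σ : AlgebraicClosure ℚ →+* ℂ) ⦃𝒳₀ S₀ : SchemeOver (AlgebraicClosure ℚ)⦄ (f₀ : 𝒳₀ ⟶ S₀),
      IsQuasiProjectiveOver 𝒳₀ → IsQuasiProjectiveOver S₀ → IrreducibleSpace S₀.left →
      AlgebraicGeometry.Smooth S₀.hom → IsSmoothProjectiveFamily ((baseChangeHom σ).map f₀) 4 →
      ∀ (s : ComplexPoints ((baseChangeHom σ).obj S₀)),
        closure {(baseChangeHomFst σ S₀).base s.pt} = (Set.univ : Set S₀.left) →
        ∀ (α : complexBetti (fiberOver ((baseChangeHom σ).map f₀) s) 4),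
          IsRationalClass α → IsOfHodgeType 4 (fiberOver ((baseChangeHom σ).map f₀) s) 4 2 2 α →
          ∀ (γ : Path s s) (β : complexBetti (fiberOver ((baseChangeHom σ).map f₀) s) 4),
            IsContinuationAlong γ α β →
              IsOfHodgeType 4 (fiberOver ((baseChangeHom σ).map f₀) s) 4 2 2 β)
    (hR : Literature.AlgebraicGeometry.FundamentalGroup.riemannExistence_finiteCovering)
    (hD : Summit.HodgeConjecture.HodgeConjecture.Theses.LinearSystemTorelli.DeligneGlobalInvariantCycles)
    (σ : AlgebraicClosure ℚ →+* ℂ)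
    (hQ2 : ∀ ⦃m : ℕ⦄ ⦃W₀ : SchemeOver (AlgebraicClosure ℚ)⦄,
      IsSmoothProjective m ((baseChangeHom σ).obj W₀) →
        ∀ (c' : complexBetti ((baseChangeHom σ).obj W₀) 4), IsRationalClass c' →
          IsOfHodgeType m ((baseChangeHom σ).obj W₀) 4 2 2 c' →
            c' ∈ algebraicClasses ((baseChangeHom σ).obj W₀) 2) :
    LinearSystemTorelli.MiddleDivisorSupportFourfold :=
  linearSystemTorelli_middleDivisorSupportFourfold_of_dominantQbarEnvelope σ
    (linearSystemTorelli_dominantQbarEnvelopeFourfoldCodimTwo_of_typeStability hT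
      (linearSystemTorelli_riemannExistence_qbarDescent_of_finiteIndex_of_riemannExistence hR) hD σ)
    (linearSystemTorelli_qbarDivisorSupportCodimTwo_of_hcQbarCodimTwo σ hQ2)

end Summit.HodgeConjecture.HodgeConjecture.Theorems

end
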